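import Literature.Analysis.FluidPDE.JiaSverak2013Lemma8Window
import Literature.Analysis.FluidPDE.JiaSverak2013Lemma8SliceTools
import Literature.Analysis.FluidPDE.LocalLeraySlabGoodSlices
import HarnessLib

/-!
# Jia–Šverák's Lemma 8, step 2 (tools): translated cut-offs and two integration lemmas

Analysis/FluidPDE support file (theorems only, no definitions, no named facts) for
`JiaSverak2013Lemma8WindowBounds.lean` (the windowed energy bound for `w = v - e^{tΔ}v₀` on the
way to `Literature.Analysis.FluidPDE.jia_sverak_2013_lemma_8`): uniform bounds for the gradient
and the Laplacian of the translated cut-offs `cutoff 1 (· - x₀)` and their squares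
(`exists_cutoff_translate_bounds`), the passage from an a.e. pointwise bound to a bound by a lower
integral without measurability of the majorant (`integral_le_toReal_lintegral_of_ae_le`), the
passage from a pointwise bound on a set to a bound of the integral
(`integral_le_setIntegral_of_abs_le`), and the trace identity `sum_fderiv_single_eq_zero_of_isDivFree`.

## References

* H. Jia, V. Šverák, SIAM J. Math. Anal. 45 (2013) 1448–1459 = arXiv:1201.1592, Lemma 8 (p. 7).
  [JiaSverak2013]
-/

noncomputable section

open MeasureTheory TopologicalSpace Set Function Filter Metric InnerProductSpace
open _root_.Topology
open scoped ENNReal NNReal RealInnerProductSpace Laplacian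

namespace Literature.Analysis.FluidPDE

open FunctionSpaces

/-! ## The translated squared cut-off `θ(x) = (cutoff 1 (x - x₀))²` -/

section Cutoff

/-- Translation commutes with the Laplacian: `Δ(f(· - a))(x) = (Δf)(x - a)`. [folklore] -/
theorem laplacian_comp_sub_right_apply {F : Type*} [NormedAddCommGroup F] [NormedSpace ℝ F]
    (f : EuclideanSpace ℝ (Fin 3) → F) (a x : EuclideanSpace ℝ (Fin 3)) :
    (Δ (fun y => f (y - a))) x = (Δ f) (x - a) := by
  rw [laplacian_eq_iteratedFDeriv_stdOrthonormalBasis, laplacian_eq_iteratedFDeriv_stdOrthonormalBasis]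
  simp only [sub_eq_add_neg, iteratedFDeriv_comp_add_right]

/-- **Uniform constants for the translated cut-offs.** There are `c₁, c_Δ ≥ 0` with
`‖D(cutoff 1 (· - x₀))(x)‖ ≤ c₁` and `|Δ((cutoff 1 (· - x₀))²)(x)| ≤ c_Δ` for all `x₀, x`.
[folklore] -/
theorem exists_cutoff_translate_bounds :
    ∃ c₁ cΔ : ℝ, 0 ≤ c₁ ∧ 0 ≤ cΔ ∧ ∀ x₀ x : EuclideanSpace ℝ (Fin 3),
      ‖fderiv ℝ (fun y => cutoff (1 : ℝ) (y - x₀)) x‖ ≤ c₁ ∧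
      |(Δ (fun y => cutoff (1 : ℝ) (y - x₀) ^ 2)) x| ≤ cΔ := by
  obtain ⟨C₁, hC₁0, hC₁⟩ := exists_norm_fderiv_cutoff_le (E := EuclideanSpace ℝ (Fin 3))
  -- the squared profile and its Laplacian
  set θ₀ : EuclideanSpace ℝ (Fin 3) → ℝ := fun y => cutoff (1 : ℝ) y ^ 2 with hθ₀
  have hθ₀s : ContDiff ℝ (⊤ : ℕ∞) θ₀ := (contDiff_cutoff 1).pow 2
  have hθ₀c : HasCompactSupport θ₀ := by
    refine HasCompactSupport.of_support_subset_isCompact (hasCompactSupport_cutoff (E := EuclideanSpace ℝ (Fin 3)) one_pos)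
      fun x hx => subset_tsupport _ ?_
    rw [mem_support] at hx ⊢
    exact fun h0 => hx (by simp only [hθ₀, h0]; ring)
  have hLc : Continuous (Δ θ₀) := continuous_laplacian (contDiff_infty.1 hθ₀s 2)
  have hLcs : HasCompactSupport (Δ θ₀) :=
    HasCompactSupport.intro hθ₀c fun x hx => laplacian_eq_zero_of_notMem_tsupport hx
  obtain ⟨CΔ, hCΔ⟩ := hLc.bounded_above_of_compact_support hLcs
  refine ⟨C₁, max CΔ 0, hC₁0, le_max_right _ _, fun x₀ x => ⟨?_, ?_⟩⟩
  · rw [fderiv_comp_sub]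
    simpa using hC₁ 1 one_pos (x - x₀)
  · have : (fun y => cutoff (1 : ℝ) (y - x₀) ^ 2) = fun y => θ₀ (y - x₀) := rfl
    rw [this, laplacian_comp_sub_right_apply]
    exact ((Real.norm_eq_abs _).symm.le.trans (hCΔ _)).trans (le_max_left _ _)

end Cutoff

/-! ## Two integration tools -/

section Tools

/-- Young's inequality `a² b ≤ (2a³ + b³)/3` for `a, b ≥ 0`. [folklore] -/
private theorem sq_mul_le_two_cube_add_cube' {a b : ℝ} (ha : 0 ≤ a) (hb : 0 ≤ b) :
    a ^ 2 * b ≤ (2 * a ^ 3 + b ^ 3) / 3 := by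
  nlinarith [sq_nonneg (a - b), mul_nonneg (mul_nonneg ha ha) hb, mul_nonneg ha hb,
    mul_nonneg (sq_nonneg (a - b)) (add_nonneg (mul_nonneg two_pos.le ha) hb)]

/-- **From an a.e. pointwise bound to a bound by a lower integral**, without measurability of the
majorant: if `g` is integrable and `g ≤ b` a.e. with `∫⁻ b < ∞`, then `∫ g ≤ (∫⁻ b).toReal`.
[folklore] -/
theorem integral_le_toReal_lintegral_of_ae_le {α : Type*} [MeasurableSpace α] {μ : Measure α}
    {g b : α → ℝ} (hg : Integrable g μ) (hle : ∀ᵐ t ∂μ, g t ≤ b t)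
    (hb : ∫⁻ t, ENNReal.ofReal (b t) ∂μ ≠ ∞) :
    ∫ t, g t ∂μ ≤ (∫⁻ t, ENNReal.ofReal (b t) ∂μ).toReal := by
  rw [integral_eq_lintegral_pos_part_sub_lintegral_neg_part hg]
  have h1 : (∫⁻ t, ENNReal.ofReal (g t) ∂μ) ≤ ∫⁻ t, ENNReal.ofReal (b t) ∂μ :=
    lintegral_mono_ae (hle.mono fun t ht => ENNReal.ofReal_le_ofReal ht)
  have h2 : (∫⁻ t, ENNReal.ofReal (g t) ∂μ).toReal ≤ (∫⁻ t, ENNReal.ofReal (b t) ∂μ).toReal :=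
    ENNReal.toReal_mono hb h1
  linarith [ENNReal.toReal_nonneg (a := ∫⁻ t, ENNReal.ofReal (-g t) ∂μ)]

/-- **From a pointwise bound on a set to a bound of the integral**: if `F` is integrable, vanishes
off `S`, and `|F| ≤ Ψ` on `S` with `Ψ` integrable on `S`, then `∫ F ≤ ∫_S Ψ`. [folklore] -/
theorem integral_le_setIntegral_of_abs_le {α : Type*} [MeasurableSpace α] {μ : Measure α}
    {F Ψ : α → ℝ} {S : Set α} (hSm : MeasurableSet S) (hF : Integrable F μ)
    (hΨ : IntegrableOn Ψ S μ) (h0 : ∀ z, z ∉ S → F z = 0) (hle : ∀ z ∈ S, |F z| ≤ Ψ z) :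
    ∫ z, F z ∂μ ≤ ∫ z in S, Ψ z ∂μ := by
  rw [← integral_indicator hSm]
  refine ((le_abs_self _).trans abs_integral_le_integral_abs).trans ?_
  refine integral_mono hF.abs (hΨ.integrable_indicator hSm) fun z => ?_
  by_cases hz : z ∈ S
  · rw [indicator_of_mem hz]; exact hle z hz
  · rw [indicator_of_notMem hz, h0 z hz, abs_zero]

/-- The trace of the derivative of a classically divergence-free field vanishes:
`∑ⱼ (De(x) eⱼ)ⱼ = 0`. [folklore] -/
theorem sum_fderiv_single_eq_zero_of_isDivFree
    {ε : EuclideanSpace ℝ (Fin 3) → EuclideanSpace ℝ (Fin 3)} (hε : VectorCalculus.IsDivFree ε)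
    (x : EuclideanSpace ℝ (Fin 3)) :
    ∑ j, fderiv ℝ ε x (EuclideanSpace.single j (1 : ℝ)) j = 0 := by
  have h := hε x
  rw [divergence_eq_sum_inner_fderiv (EuclideanSpace.basisFun (Fin 3) ℝ) ε x] at h
  simpa [EuclideanSpace.basisFun_apply, EuclideanSpace.inner_single_left] using h

end Tools

end Literature.Analysis.FluidPDE

end
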